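import Summits.CriticalPhenomena.PercolationContinuityZ3.Theorems.Transplant.Bcc111Lift
import Summits.CriticalPhenomena.PercolationContinuityZ3.Theorems.Transplant.Bcc111ClawTable
import HarnessLib

/-!
# The bcc (111)-films `F_m(bcc)`, exit-form routing certificate IV: the CLEARED SET of the film and the REDUCTION of the terminal data
# `TerminalsX` to an admissible configuration of the planar claw model

builds on p205010 (kernel theorem, internal audit signed; external expert review pending) — NOT used in this file.
Lane `prim-bschramm`, seat `prim-bschramm-p2` (gen 48; class C1b, METHOD = input substitution; memo `HOME/bschramm/P2-LATTICES.md` §159); helper file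
(`--supports stmt-CriticalPhenomena-4575 --as helper`).
* §1 the block in model coordinates (`inBlk_rel_iff`), **`Bcc111.clearedSet m z t_R t_D s_R s_D`** — the film vertices over the cleared columns
  («Bcc111ClawModel».`inDB` of the class `(min t_R 3, min t_D 3, min s_R 3, min s_D 3)`, relative to `z`) minus the BOTTOM vertices over the columns `rem0`
  and the TOP vertices over the columns `remM` —, the two sandwich conditions of the node «HexShadowVRouteDataX».`ShapedLinkageX 3`, and membership
  lemmas for the rerouting set `W ∩ \overline{blkR 3 z t_R s_R}` (interior levels over rerouting columns; bottom / top vertices where not removed);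
* §2 **`Bcc111.certE_of_terminalsX` / `certW_of_terminalsX` / `tyOK_of_levels`**: the terminal data certified by the generic exit-form routing make the
  columns of `E₁, E₂, w'` (relative to `z`) and the stacked type an ADMISSIBLE configuration of the model («Bcc111ClawModel».`admissible`).
[cite: DuminilCopinSidoraviciusTassion2016, §2.3 (proof of Fact 2: the ball B̄_R(z), u', v', w' and the path π)] [cite: ConwaySloane1999, Ch. 4 §7.1]
-/

noncomputable section

namespace Summit.CriticalPhenomena.PercolationContinuityZ3.Theorems.Transplant

namespace Bcc111

open MeasureTheory Literature.Probability.Percolation Literature.Probability.LatticeModels SimpleGraph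
open Slab111 (lev)
open BccClawX (Pt rel)
open Bcc111Claw (tnZ inBlk isPocket inRB inDB rem0 remM remAny certE certW tyOK)
open scoped Classical

variable {m : ℕ}

/-! ## §1 The cleared set -/

/-- **The clipped block in model coordinates**: `inBlk (min t 3) (min s 3)` of the relative column is membership in `blkR 3 z t s`. [folklore] -/
theorem inBlk_rel_iff {z w : Site 2} {t s : ℕ} : inBlk (min t 3) (min s 3) (rel z w) = true ↔ w ∈ blkR 3 z t s := by
  rw [mem_blkR, mem_hexBall]
  have h0 : (rel z w).1 = w 0 - z 0 := rfl
  have h1 : (rel z w).2 = w 1 - z 1 := rfl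
  have hb := abs_le_triNorm (w - z)
  have hc : |(w - z) 0 + (w - z) 1| ≤ triNorm (w - z) := (le_max_right _ _).trans (le_max_right _ _)
  simp only [Pi.sub_apply] at hb hc
  rw [abs_le] at hb hc
  simp only [inBlk, Bool.and_eq_true, decide_eq_true_eq, tnZ_rel, h0, h1]
  push_cast
  omega

/-- **THE CLEARED SET of the bcc (111) certificate**: the film vertices over the cleared columns of the class `(min t_R 3, min t_D 3, min s_R 3, min s_D 3)`
(the block `blkR 3 z t_D s_D` minus the R-pockets), except the bottom vertices over the columns `rem0` and the top vertices over the columns `remM`.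
[cite: DuminilCopinSidoraviciusTassion2016, §2.3 (proof of Fact 2: the ball B̄_R(z))] -/
def clearedSet (m : ℕ) (z : Site 2) (tR tD sR sD : ℕ) : Set (bfilm m) :=
  {x | inDB (min tR 3) (min tD 3) (min sR 3) (min sD 3) (rel z (sh x)) = true ∧
    ¬ (lev (pt x) = 0 ∧ rem0 (min tR 3) (min sR 3) (rel z (sh x)) = true) ∧
    ¬ (lev (pt x) = m ∧ remM (min tR 3) (min sR 3) (rel z (sh x)) = true)}

/-- Membership in the cleared set. [folklore] -/
theorem mem_clearedSet {z : Site 2} {tR tD sR sD : ℕ} {x : bfilm m} :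
    x ∈ clearedSet m z tR tD sR sD ↔ inDB (min tR 3) (min tD 3) (min sR 3) (min sD 3) (rel z (sh x)) = true ∧
      ¬ (lev (pt x) = 0 ∧ rem0 (min tR 3) (min sR 3) (rel z (sh x)) = true) ∧
      ¬ (lev (pt x) = m ∧ remM (min tR 3) (min sR 3) (rel z (sh x)) = true) := Iff.rfl

/-- Pockets and removal columns lie off the unit hexagon (`tnZ ≥ 2`). [folklore] -/
theorem two_le_tnZ_of_special {tR sR : ℕ} {p : Pt} (h : isPocket tR sR p = true ∨ rem0 tR sR p = true ∨ remM tR sR p = true) : 2 ≤ tnZ p := by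
  rcases h with h | h | h
  · simp only [isPocket, Bool.and_eq_true, decide_eq_true_eq] at h; exact h.1.2
  · simp only [rem0, Bool.and_eq_true, decide_eq_true_eq] at h; exact h.1.2
  · simp only [remM, Bool.and_eq_true, decide_eq_true_eq] at h; exact h.1.2

/-- **First sandwich condition**: the cleared set lies over the block `blkR 3 z t_D s_D`. [folklore] -/
theorem sh_mem_blkR_of_mem_clearedSet {z : Site 2} {tR tD sR sD : ℕ} :
    ∀ x ∈ clearedSet m z tR tD sR sD, (hexShadow m).sh x ∈ blkR 3 z tD sD := by
  intro x hx
  have h := hx.1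
  simp only [inDB, Bool.and_eq_true] at h
  rw [hexShadow_sh]; exact inBlk_rel_iff.1 h.1

/-- **Second sandwich condition**: every vertex over `hexBall z 1 ∩ blkR 3 z t_D s_D` is cleared. [folklore] -/
theorem mem_clearedSet_of_hexBall_one {z : Site 2} {tR tD sR sD : ℕ} :
    ∀ x : bfilm m, (hexShadow m).sh x ∈ hexBall z 1 → (hexShadow m).sh x ∈ blkR 3 z tD sD → x ∈ clearedSet m z tR tD sR sD := by
  intro x h1 hB
  rw [hexShadow_sh] at h1 hB
  rw [mem_hexBall] at h1
  have ht : tnZ (rel z (sh x)) ≤ 1 := by rw [tnZ_rel]; exact h1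
  have hnot : ¬ (isPocket (min tR 3) (min sR 3) (rel z (sh x)) = true ∨ rem0 (min tR 3) (min sR 3) (rel z (sh x)) = true ∨
      remM (min tR 3) (min sR 3) (rel z (sh x)) = true) := fun h => by have := two_le_tnZ_of_special h; omega
  refine ⟨?_, fun h => hnot (Or.inr (Or.inl h.2)), fun h => hnot (Or.inr (Or.inr h.2))⟩
  simp only [inDB, Bool.and_eq_true, Bool.not_eq_true']
  exact ⟨inBlk_rel_iff.2 hB, by simpa using fun h => hnot (Or.inl h)⟩

/-- **The rerouting set in model terms**: `x ∈ W ∩ \overline{blkR 3 z t_R s_R}` iff its column is a rerouting column and it is not a removed extreme vertex.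
[folklore] -/
theorem mem_WR_iff {z : Site 2} {tR tD sR sD : ℕ} (htRD : tR ≤ tD) (hsRD : sR ≤ sD) {x : bfilm m} :
    x ∈ clearedSet m z tR tD sR sD ∩ (hexShadow m).lift (blkR 3 z tR sR) ↔
      inRB (min tR 3) (min sR 3) (rel z (sh x)) = true ∧ ¬ (lev (pt x) = 0 ∧ rem0 (min tR 3) (min sR 3) (rel z (sh x)) = true) ∧
        ¬ (lev (pt x) = m ∧ remM (min tR 3) (min sR 3) (rel z (sh x)) = true) := by
  rw [Set.mem_inter_iff, HexShadow.mem_lift, hexShadow_sh, mem_clearedSet, ← inBlk_rel_iff]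
  simp only [inRB, inDB, Bool.and_eq_true, Bool.not_eq_true']
  constructor
  · rintro ⟨⟨⟨-, hp⟩, h0, hm⟩, hR⟩; exact ⟨⟨hR, hp⟩, h0, hm⟩
  · rintro ⟨⟨hR, hp⟩, h0, hm⟩
    refine ⟨⟨⟨?_, hp⟩, h0, hm⟩, hR⟩
    simp only [inBlk, Bool.and_eq_true, decide_eq_true_eq] at hR ⊢
    have h1 : (min (tR : ℤ) 3) ≤ min (tD : ℤ) 3 := min_le_min (by exact_mod_cast htRD) le_rfl
    have h2 : (min (sR : ℤ) 3) ≤ min (sD : ℤ) 3 := min_le_min (by exact_mod_cast hsRD) le_rfl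
    push_cast at hR ⊢
    exact ⟨⟨hR.1.1, hR.1.2.trans h1⟩, hR.2.trans h2⟩

/-- A vertex at a level in `[1, m−1]` over a rerouting column lies in the rerouting set. [folklore] -/
theorem mem_WR_of_lev {z : Site 2} {tR tD sR sD : ℕ} (htRD : tR ≤ tD) (hsRD : sR ≤ sD) {x : bfilm m}
    (hR : inRB (min tR 3) (min sR 3) (rel z (sh x)) = true) (h1 : 1 ≤ lev (pt x)) (hm : lev (pt x) ≤ (m : ℤ) - 1) :
    x ∈ clearedSet m z tR tD sR sD ∩ (hexShadow m).lift (blkR 3 z tR sR) :=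
  (mem_WR_iff htRD hsRD).2 ⟨hR, fun h => by omega, fun h => by omega⟩

/-- A vertex at a level in `[1, m−1]` over a cleared column lies in the cleared set. [folklore] -/
theorem mem_W_of_lev {z : Site 2} {tR tD sR sD : ℕ} {x : bfilm m} (hD : inDB (min tR 3) (min tD 3) (min sR 3) (min sD 3) (rel z (sh x)) = true)
    (h1 : 1 ≤ lev (pt x)) (hm : lev (pt x) ≤ (m : ℤ) - 1) : x ∈ clearedSet m z tR tD sR sD :=
  ⟨hD, fun h => by omega, fun h => by omega⟩

/-- A bottom vertex over a rerouting column whose bottom vertex is not removed lies in the rerouting set (`m ≥ 1`). [folklore] -/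
theorem mem_WR_of_bottom {z : Site 2} {tR tD sR sD : ℕ} (htRD : tR ≤ tD) (hsRD : sR ≤ sD) (hm : 1 ≤ m) {x : bfilm m}
    (hR : inRB (min tR 3) (min sR 3) (rel z (sh x)) = true) (h0 : lev (pt x) = 0) (hn : rem0 (min tR 3) (min sR 3) (rel z (sh x)) = false) :
    x ∈ clearedSet m z tR tD sR sD ∩ (hexShadow m).lift (blkR 3 z tR sR) :=
  (mem_WR_iff htRD hsRD).2 ⟨hR, fun h => by rw [hn] at h; exact Bool.false_ne_true h.2, fun h => by
    have h1 := h.1; have : (1 : ℤ) ≤ m := by exact_mod_cast hm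
    omega⟩

/-- A top vertex over a rerouting column whose top vertex is not removed lies in the rerouting set (`m ≥ 1`). [folklore] -/
theorem mem_WR_of_top {z : Site 2} {tR tD sR sD : ℕ} (htRD : tR ≤ tD) (hsRD : sR ≤ sD) (hm : 1 ≤ m) {x : bfilm m}
    (hR : inRB (min tR 3) (min sR 3) (rel z (sh x)) = true) (htop : lev (pt x) = m) (hn : remM (min tR 3) (min sR 3) (rel z (sh x)) = false) :
    x ∈ clearedSet m z tR tD sR sD ∩ (hexShadow m).lift (blkR 3 z tR sR) :=
  (mem_WR_iff htRD hsRD).2 ⟨hR, fun h => by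
    have h1 := h.1; have : (1 : ℤ) ≤ m := by exact_mod_cast hm
    omega, fun h => by rw [hn] at h; exact Bool.false_ne_true h.2⟩

/-! ## §2 The reduction of the terminal data to an admissible configuration -/

/-- The hexagonal norm is symmetric. [folklore] -/
private theorem triNorm_sub_comm' (a b : Site 2) : triNorm (a - b) = triNorm (b - a) := by
  simp only [triNorm, Pi.sub_apply]
  rw [show b 0 - a 0 = -(a 0 - b 0) by ring, show b 1 - a 1 = -(a 1 - b 1) by ring, show -(a 0 - b 0) + -(a 1 - b 1) = -((a 0 - b 0) + (a 1 - b 1)) by ring,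
    abs_neg, abs_neg, abs_neg]

/-- A vertex outside the cleared set: its column is not cleared, or it is a removed bottom / top vertex. [folklore] -/
theorem not_mem_clearedSet_iff {z : Site 2} {tR tD sR sD : ℕ} {x : bfilm m} : x ∉ clearedSet m z tR tD sR sD ↔
    inDB (min tR 3) (min tD 3) (min sR 3) (min sD 3) (rel z (sh x)) = false ∨
      (lev (pt x) = 0 ∧ rem0 (min tR 3) (min sR 3) (rel z (sh x)) = true) ∨ (lev (pt x) = m ∧ remM (min tR 3) (min sR 3) (rel z (sh x)) = true) := by
  rw [mem_clearedSet]
  constructor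
  · intro h
    by_cases hD : inDB (min tR 3) (min tD 3) (min sR 3) (min sD 3) (rel z (sh x)) = true
    · right; by_contra hc; push Not at hc; exact h ⟨hD, fun h0 => hc.1 h0.1 h0.2, fun hmm => hc.2 hmm.1 hmm.2⟩
    · left; simpa using hD
  · rintro (h | h | h) ⟨hD, h0, hmm⟩
    · rw [h] at hD; exact Bool.false_ne_true hD
    · exact h0 h
    · exact hmm h

/-- **A neighbour of a cleared vertex outside the cleared set**, in model terms: either it is the removed elevator mate (then the column of the cleared vertex is a
removal column), or it lies over a neighbour column `a + d` which is not cleared or is a removal column. [folklore] -/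
theorem exit_cases {z : Site 2} {tR tD sR sD : ℕ} {x o : bfilm m} (hx : x ∈ clearedSet m z tR tD sR sD) (ho : o ∉ clearedSet m z tR tD sR sD)
    (hadj : (film m).Adj x o ∨ (film m).Adj o x) :
    (sh o = sh x ∧ remAny (min tR 3) (min sR 3) (rel z (sh x)) = true) ∨
      ∃ d ∈ Bcc111Claw.dirs, rel z (sh o) = ((rel z (sh x)).1 + d.1, (rel z (sh x)).2 + d.2) ∧
        (inDB (min tR 3) (min tD 3) (min sR 3) (min sD 3) (rel z (sh o)) = false ∨ remAny (min tR 3) (min sR 3) (rel z (sh o)) = true) := by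
  have hlip : triNorm (sh o - sh x) ≤ 1 := by
    rcases hadj with h | h
    · have := triNorm_sh_sub_le_one h; rwa [triNorm_sub_comm'] at this
    · exact triNorm_sh_sub_le_one h
  have ho' := not_mem_clearedSet_iff.1 ho
  have hrem : ∀ {p : Pt}, (lev (pt o) = 0 ∧ rem0 (min tR 3) (min sR 3) p = true) ∨ (lev (pt o) = m ∧ remM (min tR 3) (min sR 3) p = true) →
      remAny (min tR 3) (min sR 3) p = true := fun h => by
    rcases h with h | h
    · simp [remAny, h.2]
    · simp [remAny, h.2]
  rcases eq_dirs_of_triNorm_le_one hlip with h0 | ⟨d, hd, hdd⟩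
  · have hso : sh o = sh x := sub_eq_zero.1 h0
    left
    refine ⟨hso, ?_⟩
    rw [hso] at ho'
    rcases ho' with h | h
    · rw [hx.1] at h; exact absurd h (by simp)
    · exact hrem h
  · right
    have hso : sh o = sh x + dvec d := by rw [← hdd]; abel
    refine ⟨d, hd, by rw [hso, rel_add_dvec], ?_⟩
    rcases ho' with h | h
    · exact Or.inl h
    · exact Or.inr (hrem h)

/-- Relative columns are injective. [folklore] -/
theorem rel_injective (z : Site 2) {v w : Site 2} (h : rel z v = rel z w) : v = w := by
  rw [← BccClawX.pt_rel z v, h, BccClawX.pt_rel]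

/-- The centre has relative column `(0,0)`. [folklore] -/
theorem rel_eq_zero_iff (z w : Site 2) : rel z w = (0, 0) ↔ w = z := by
  constructor
  · intro h; apply rel_injective z; rw [h]; simp [rel]
  · rintro rfl; simp [rel]

/-- **The column of `E₁` (and of `E₂`) is certified** by the terminal data of the exit-form routing. [cite: DuminilCopinSidoraviciusTassion2016, §2.3 (u', v')] -/
theorem certE_of_terminalsX {z : Site 2} {tR tD sR sD : ℕ} {E₁ E₂ w' : bfilm m}
    (hT : (hexShadow m).TerminalsX 3 z tR tD sR sD (clearedSet m z tR tD sR sD) E₁ E₂ w') :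
    certE (min tR 3) (min tD 3) (min sR 3) (min sD 3) (rel z (sh E₁)) = true ∧ certE (min tR 3) (min tD 3) (min sR 3) (min sD 3) (rel z (sh E₂)) = true := by
  obtain ⟨o₁, a₁, a₂, o₂, ho₁, -, -, ho₂, ho₁W, ho₂W, -⟩ := hT.nbrs
  have key : ∀ {E o : bfilm m}, E ∈ clearedSet m z tR tD sR sD → (hexShadow m).sh E ∈ blkR 3 z tR sR → (hexShadow m).sh E ≠ z →
      o ∉ clearedSet m z tR tD sR sD → ((film m).Adj E o ∨ (film m).Adj o E) → certE (min tR 3) (min tD 3) (min sR 3) (min sD 3) (rel z (sh E)) = true := by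
    intro E o hE hER hEz ho hadj
    rw [hexShadow_sh] at hER hEz
    have hRB : inRB (min tR 3) (min sR 3) (rel z (sh E)) = true := by
      have hp := hE.1
      simp only [inDB, Bool.and_eq_true] at hp
      simp only [inRB, Bool.and_eq_true]
      exact ⟨inBlk_rel_iff.2 hER, hp.2⟩
    have hne : (rel z (sh E) == (0, 0)) = false := by
      rw [beq_eq_false_iff_ne, ne_eq, rel_eq_zero_iff]; exact hEz
    simp only [certE, hRB, hne, Bool.not_false, Bool.true_and, Bool.or_eq_true, List.any_eq_true, Bool.not_eq_true']
    rcases exit_cases hE ho hadj with ⟨-, h⟩ | ⟨d, hd, hrel, h⟩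
    · exact Or.inl h
    · right; refine ⟨d, hd, ?_⟩; rw [← hrel]; exact h
  exact ⟨key hT.E₁W hT.E₁R hT.E₁z ho₁W (Or.inr ho₁), key hT.E₂W hT.E₂R hT.E₂z ho₂W (Or.inl ho₂)⟩

/-- **The column of `w'` is certified** (given the columns of `E₁, E₂`) by the terminal data of the exit-form routing. [cite: DuminilCopinSidoraviciusTassion2016, §2.3 (w', π)] -/
theorem certW_of_terminalsX {z : Site 2} {tR tD sR sD : ℕ} {E₁ E₂ w' : bfilm m}
    (hT : (hexShadow m).TerminalsX 3 z tR tD sR sD (clearedSet m z tR tD sR sD) E₁ E₂ w') :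
    certW (min tR 3) (min tD 3) (min sR 3) (min sD 3) (rel z (sh E₁)) (rel z (sh E₂)) (rel z (sh w')) = true := by
  obtain ⟨x, hx, hxW, -, hxz, hx1, hx2⟩ := hT.w'x
  have hw'z := hT.w'z; have hw'1 := hT.w'E₁; have hw'2 := hT.w'E₂
  rw [hexShadow_sh] at hxz hx1 hx2 hw'z hw'1 hw'2
  have hD : inDB (min tR 3) (min tD 3) (min sR 3) (min sD 3) (rel z (sh w')) = true := hT.w'W.1
  have n0 : (rel z (sh w') == (0, 0)) = false := by rw [beq_eq_false_iff_ne, ne_eq, rel_eq_zero_iff]; exact hw'z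
  have n1 : (rel z (sh w') == rel z (sh E₁)) = false := by rw [beq_eq_false_iff_ne]; exact fun h => hw'1 (rel_injective z h)
  have n2 : (rel z (sh w') == rel z (sh E₂)) = false := by rw [beq_eq_false_iff_ne]; exact fun h => hw'2 (rel_injective z h)
  simp only [certW, hD, n0, n1, n2, Bool.not_false, Bool.true_and, Bool.or_eq_true, List.any_eq_true, Bool.and_eq_true, Bool.not_eq_true',
    beq_eq_false_iff_ne, ne_eq, and_assoc]
  rcases exit_cases hT.w'W hxW (Or.inl hx) with ⟨-, h⟩ | ⟨d, hd, hrel, h⟩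
  · exact Or.inl h
  · right
    refine ⟨d, hd, ?_⟩
    rw [← hrel, rel_eq_zero_iff]
    exact ⟨hxz, fun e => hx1 (rel_injective z e), fun e => hx2 (rel_injective z e), h⟩

/-- **The stacked type is admissible**: for two cleared vertices in one column at levels `lo < hi`, the type `3·min lo 2 + min (m − hi) 2` passes `tyOK`
(a cleared bottom vertex sits over a column whose bottom vertex is not removed; likewise at the top). [folklore] -/
theorem tyOK_of_levels {z : Site 2} {tR tD sR sD : ℕ} {Elo Ehi : bfilm m} (hlo : Elo ∈ clearedSet m z tR tD sR sD) (hhi : Ehi ∈ clearedSet m z tR tD sR sD)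
    (hsh : sh Elo = sh Ehi) (τlo τhi : ℕ) (hτlo : (τlo : ℤ) = min (lev (pt Elo)) 2) (hτhi : (τhi : ℤ) = min ((m : ℤ) - lev (pt Ehi)) 2) :
    tyOK (min tR 3) (min sR 3) (rel z (sh Elo)) (rel z (sh Ehi)) (3 * τlo + τhi) = true := by
  have h0lo : 0 ≤ lev (pt Elo) := Elo.2.1
  have hmhi : lev (pt Ehi) ≤ m := Ehi.2.2
  have hτlo2 : τlo ≤ 2 := by have := min_le_right (lev (pt Elo)) 2; omega
  have hτhi2 : τhi ≤ 2 := by have := min_le_right ((m : ℤ) - lev (pt Ehi)) 2; omega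
  have hdiv : (3 * τlo + τhi) / 3 = τlo := by omega
  have hmod : (3 * τlo + τhi) % 3 = τhi := by omega
  have hsame : (rel z (sh Elo) == rel z (sh Ehi)) = true := by rw [beq_iff_eq, hsh]
  simp only [tyOK, hsame, if_true, hdiv, hmod, Bool.and_eq_true, decide_eq_true_eq, Bool.or_eq_true, Bool.not_eq_true', beq_eq_false_iff_ne,
    ne_eq]
  refine ⟨⟨by omega, ?_⟩, ?_⟩
  · by_cases h : τlo = 0
    · right
      have hl0 : lev (pt Elo) = 0 := by
        rcases le_total (lev (pt Elo)) 2 with h' | h'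
        · rw [min_eq_left h'] at hτlo; omega
        · rw [min_eq_right h'] at hτlo; omega
      by_contra hc
      exact hlo.2.1 ⟨hl0, by simpa using hc⟩
    · exact Or.inl h
  · by_cases h : τhi = 0
    · right
      have hlm : lev (pt Ehi) = m := by
        rcases le_total ((m : ℤ) - lev (pt Ehi)) 2 with h' | h'
        · rw [min_eq_left h'] at hτhi; omega
        · rw [min_eq_right h'] at hτhi; omega
      by_contra hc
      exact hhi.2.2 ⟨hlm, by rw [← hsh]; simpa using hc⟩
    · exact Or.inl h

end Bcc111

end Summit.CriticalPhenomena.PercolationContinuityZ3.Theorems.Transplant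

end
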